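import Summits.CriticalPhenomena.CardyFormulaZ2.Theorems.SymmetryUpgradeR.Negative.DiracChords
import HarnessLib

/-!
# Deterministic simple chords, II: chordality, non-tracing, reparametrised final segments

Crux `SymmetryUpgradeR` (stmt-CriticalPhenomena-17239, route `CardySelfRefinement`), line `SketchIdeatorTwo`,
negative side: the lead's structural theorem behind the verdict on stubs S7 `stub_pinnedSchrammLSW` /
S5a `stub_middleDrivingMartingale` — the typed domain Markov property `ChordalFamily.IsDomainMarkov`
cannot carry Schramm's increment argument (headline in `TiltedRayFamily.lean`:
`typedSchrammPrinciple_fails`).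

This file: a deterministic simple chord family `D ↦ δ_{[c D]}` is chordal (`isChordal_dirac`) and
almost surely traces no boundary arc — clause (ii) of `SymmetryUpgradeR` (`nonTracing_dirac`; a
preconnected subset of `{a, b}` is a point); and the reparametrisation lemma `mk_segCurve_reparam`
(final segments of `γ ∘ φ` from `r₂` and of `γ` from `r₁ = φ r₂` define the same curve class), the
analytic input of the rigidity of the Markov kernel in part III.

References: W. Werner, *Lectures on two-dimensional critical percolation* (2007), §3.2 (2), Lemma 3.3;
O. Schramm, Israel J. Math. 118 (2000), §1; G. F. Lawler, *Conformally Invariant Processes in the Plane*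
(2005), §6.3.
-/

noncomputable section

open Set MeasureTheory Topology Filter Metric
open scoped unitInterval ENNReal NNReal
open UpperHalfPlane (upperHalfPlaneSet)

namespace Summit.CriticalPhenomena.CardyFormulaZ2.Theorems.SymmetryUpgradeR.Negative

open Literature.Probability.RandomPlanarGeometry Literature.Probability.RandomPlanarGeometry.ChordalFamily

/-! ### Chordality and non-tracing of deterministic simple chords -/

namespace IsSimpleChordFamily

variable {c : DobrushinDomain → Curve ℂ} (hc : IsSimpleChordFamily c)
include hc

/-- Every point of the chord lies in the closed domain. [folklore] -/
theorem apply_mem_closure (D : DobrushinDomain) (s : I) : c D s ∈ closure D.carrier := by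
  rcases eq_or_lt_of_le s.2.1 with h0 | h0
  · have : s = 0 := Subtype.ext h0.symm
    subst this
    rw [hc.apply_zero]
    exact frontier_subset_closure (D.pt_mem_frontier 0)
  rcases eq_or_lt_of_le s.2.2 with h1 | h1
  · have : s = 1 := Subtype.ext h1
    subst this
    rw [hc.apply_one]
    exact frontier_subset_closure (D.pt_mem_frontier 1)
  · exact subset_closure (hc.mem_carrier D s h0 h1)

/-- **Deterministic simple chords form a chordal family.** [folklore] -/
theorem isChordal_dirac : ChordalFamily.IsChordal (fun D => Measure.dirac (CurveClass.mk (c D))) := by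
  intro D
  refine ⟨inferInstance, ?_⟩
  change ∀ᵐ γ ∂(Measure.dirac (CurveClass.mk (c D))), _
  rw [ae_dirac_eq, eventually_pure]
  refine ⟨hc.apply_zero D, hc.apply_one D, ?_⟩
  rintro _ ⟨s, rfl⟩
  exact hc.apply_mem_closure D s

/-- The chord meets the frontier of the domain only at the marked points. [folklore] -/
theorem range_inter_frontier (D : DobrushinDomain) :
    Set.range (c D) ∩ frontier D.carrier ⊆ {D.pt 0, D.pt 1} := by
  rintro _ ⟨⟨s, rfl⟩, hf⟩
  rcases eq_or_lt_of_le s.2.1 with h0 | h0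
  · have : s = 0 := Subtype.ext h0.symm
    subst this
    exact Or.inl (hc.apply_zero D)
  rcases eq_or_lt_of_le s.2.2 with h1 | h1
  · have : s = 1 := Subtype.ext h1
    subst this
    exact Or.inr (hc.apply_one D)
  · exact absurd (hc.mem_carrier D s h0 h1) (Set.disjoint_right.1 D.disjoint_carrier_frontier hf)

omit hc in
/-- A preconnected subset of a pair of points of the plane is a subsingleton. [folklore] -/
theorem subsingleton_of_isPreconnected_subset_pair {S : Set ℂ} {a b : ℂ} (hS : IsPreconnected S)
    (hab : S ⊆ {a, b}) : S.Subsingleton := by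
  by_cases heq : a = b
  · subst heq
    intro x hx y hy
    have hx' := hab hx
    have hy' := hab hy
    simp only [mem_insert_iff, mem_singleton_iff, or_self] at hx' hy'
    rw [hx', hy']
  have hd : 0 < dist a b := dist_pos.2 heq
  set u := {w : ℂ | dist w a < dist w b} with hu_def
  set v := {w : ℂ | dist w b < dist w a} with hv_def
  have hu : IsOpen u :=
    isOpen_lt (continuous_id.dist continuous_const) (continuous_id.dist continuous_const)
  have hv : IsOpen v :=
    isOpen_lt (continuous_id.dist continuous_const) (continuous_id.dist continuous_const)
  have huv : Disjoint u v :=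
    Set.disjoint_left.2 fun w (h₁ : dist w a < dist w b) (h₂ : dist w b < dist w a) => lt_asymm h₁ h₂
  have hau : a ∈ u := by
    change dist a a < dist a b
    rwa [dist_self]
  have hbv : b ∈ v := by
    change dist b b < dist b a
    rw [dist_self, dist_comm]
    exact hd
  have hbu : b ∉ u := fun h => Set.disjoint_left.1 huv h hbv
  have hav : a ∉ v := fun h => Set.disjoint_left.1 huv hau h
  have hsub : S ⊆ u ∪ v := by
    intro w hw
    rcases hab hw with rfl | rfl
    · exact Or.inl hau
    · exact Or.inr hbv
  intro x hx y hy
  rcases hS.subset_or_subset hu hv huv hsub with h | h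
  · have key : ∀ w ∈ S, w = a := by
      intro w hw
      rcases hab hw with rfl | rfl
      · rfl
      · exact absurd (h hw) hbu
    rw [key x hx, key y hy]
  · have key : ∀ w ∈ S, w = b := by
      intro w hw
      rcases hab hw with rfl | rfl
      · exact absurd (h hw) hav
      · rfl
    rw [key x hx, key y hy]

/-- **Deterministic simple chords trace no boundary arc** (clause (ii) of `SymmetryUpgradeR`). [folklore] -/
theorem nonTracing_dirac (D : DobrushinDomain) :
    ∀ᵐ γ ∂(Measure.dirac (CurveClass.mk (c D))), ∀ c' : Curve ℂ, CurveClass.mk c' = γ →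
      ∀ s t : I, s < t → c' '' Set.Icc s t ⊆ frontier D.carrier → (c' '' Set.Icc s t).Subsingleton := by
  rw [ae_dirac_eq, eventually_pure]
  intro c' hc' s t _ hsub
  have hrange : c'.range = (c D).range :=
    Curve.range_eq_of_dist_eq_zero (CurveClass.mk_eq_mk_iff_dist_eq_zero.1 hc')
  have hpre : IsPreconnected (c' '' Set.Icc s t) :=
    (isPreconnected_Icc).image _ c'.continuous.continuousOn
  refine subsingleton_of_isPreconnected_subset_pair (a := D.pt 0) (b := D.pt 1) hpre ?_
  refine Subset.trans ?_ (hc.range_inter_frontier D)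
  intro w hw
  refine ⟨?_, hsub hw⟩
  obtain ⟨u, -, rfl⟩ := hw
  have : c' u ∈ c'.range := ⟨u, rfl⟩
  rw [hrange] at this
  exact this

end IsSimpleChordFamily

/-! ### Re-parametrising a final segment -/

/-- **Final segments of reparametrised curves.** If `φ` is an increasing reparametrisation with
`φ r₂ = r₁` (`r₁, r₂ < 1`), the final segment of `γ ∘ φ` from `r₂` and the final segment of `γ` from
`r₁` define the same curve class. [folklore] -/
theorem mk_segCurve_reparam (γ : Curve ℂ) (φ : I ≃o I) {r₁ r₂ : ℝ} (h₁ : r₁ ∈ Icc (0 : ℝ) 1)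
    (h₂ : r₂ ∈ Icc (0 : ℝ) 1) (hr₁ : r₁ < 1) (hr₂ : r₂ < 1) (hφ : φ ⟨r₂, h₂⟩ = ⟨r₁, h₁⟩) :
    CurveClass.mk (segCurve (γ.reparam φ) r₂ (1 - r₂)) = CurveClass.mk (segCurve γ r₁ (1 - r₁)) := by
  -- the affine map onto `[r₂, 1]`
  set A : ℝ → I := fun t => projIcc 0 1 zero_le_one (r₂ + (1 - r₂) * t) with hA
  have hAval : ∀ t ∈ Icc (0 : ℝ) 1, ((A t : I) : ℝ) = r₂ + (1 - r₂) * t := by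
    intro t ht
    have hmem : r₂ + (1 - r₂) * t ∈ Icc (0 : ℝ) 1 :=
      ⟨by nlinarith [h₂.1, h₂.2, ht.1], by nlinarith [h₂.1, h₂.2, ht.1, ht.2]⟩
    simp only [hA, projIcc_of_mem _ hmem]
  have hAcont : Continuous A := continuous_projIcc.comp (by fun_prop)
  -- the real reparametrisation `G`
  set G : ℝ → ℝ := fun t => (((φ (A t) : I) : ℝ) - r₁) / (1 - r₁) with hG
  have h1r₁ : 0 < 1 - r₁ := sub_pos.2 hr₁
  have hGcont : Continuous G :=
    ((continuous_subtype_val.comp (φ.continuous.comp hAcont)).sub continuous_const).div_const _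
  have hφge : ∀ t ∈ Icc (0 : ℝ) 1, r₁ ≤ ((φ (A t) : I) : ℝ) := by
    intro t ht
    have hle : (⟨r₂, h₂⟩ : I) ≤ A t := by
      change r₂ ≤ ((A t : I) : ℝ)
      rw [hAval t ht]
      nlinarith [h₂.2, ht.1]
    have := φ.monotone hle
    rw [hφ] at this
    exact this
  have hGmem : ∀ t ∈ Icc (0 : ℝ) 1, G t ∈ Icc (0 : ℝ) 1 := by
    intro t ht
    have hle1 : ((φ (A t) : I) : ℝ) ≤ 1 := (φ (A t)).2.2
    refine ⟨div_nonneg (sub_nonneg.2 (hφge t ht)) h1r₁.le, ?_⟩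
    rw [div_le_one h1r₁]
    linarith
  have hG0 : G 0 = 0 := by
    have hA0 : A 0 = ⟨r₂, h₂⟩ := Subtype.ext (by rw [hAval 0 ⟨le_rfl, zero_le_one⟩]; ring)
    simp only [hG, hA0, hφ, sub_self, zero_div]
  have hG1 : G 1 = 1 := by
    have hA1 : A 1 = 1 := Subtype.ext (by rw [hAval 1 ⟨zero_le_one, le_rfl⟩]; simp)
    simp only [hG, hA1]
    rw [show φ 1 = 1 from φ.map_top]
    exact div_self h1r₁.ne'
  have hGmono : StrictMono fun t : I => G t := by
    intro u v huv
    have hA' : A u < A v := by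
      change ((A u : I) : ℝ) < ((A v : I) : ℝ)
      rw [hAval u u.2, hAval v v.2]
      have : (u : ℝ) < v := huv
      nlinarith [h₂.2]
    have hφ' : ((φ (A u) : I) : ℝ) < ((φ (A v) : I) : ℝ) := φ.strictMono hA'
    simp only [hG]
    exact div_lt_div_of_pos_right (by linarith) h1r₁
  -- the reparametrisation `g : I → I` and the order isomorphism `k`
  set g : I → I := fun t => ⟨G t, hGmem t t.2⟩ with hg
  have hgmono : StrictMono g := fun u v huv => hGmono huv
  have hgsurj : Function.Surjective g := by
    intro y
    have hy : (y : ℝ) ∈ Icc (G 0) (G 1) := by rw [hG0, hG1]; exact y.2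
    obtain ⟨t, ht, hty⟩ := intermediate_value_Icc zero_le_one hGcont.continuousOn hy
    exact ⟨⟨t, ht⟩, Subtype.ext hty⟩
  set k : I ≃o I := StrictMono.orderIsoOfSurjective g hgmono hgsurj with hk
  have hk_apply : ∀ t : I, ((k t : I) : ℝ) = G t := fun t => rfl
  -- the two final segments differ by `k`
  have hseg : segCurve (γ.reparam φ) r₂ (1 - r₂) = (segCurve γ r₁ (1 - r₁)).reparam k := by
    refine Curve.ext (ContinuousMap.ext fun t => ?_)
    change segCurve (γ.reparam φ) r₂ (1 - r₂) t = segCurve γ r₁ (1 - r₁) (k t)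
    rw [segCurve_apply, segCurve_apply, Curve.reparam_apply]
    congr 1
    have hval : r₁ + (1 - r₁) * ((k t : I) : ℝ) = ((φ (A t) : I) : ℝ) := by
      rw [hk_apply]
      simp only [hG]
      field_simp
      ring
    rw [hval, projIcc_val]
  rw [hseg, CurveClass.mk_reparam]

/-- Registered form (crux stmt-CriticalPhenomena-17239, `--supports`): **deterministic simple chords
trace no boundary arc** (clause (ii) of `SymmetryUpgradeR`). [folklore] -/
theorem dirac_nonTracing :
    ∀ c : DobrushinDomain → Curve ℂ, IsSimpleChordFamily c → ∀ D : DobrushinDomain,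
      ∀ᵐ γ ∂(Measure.dirac (CurveClass.mk (c D))), ∀ c' : Curve ℂ, CurveClass.mk c' = γ →
        ∀ s t : unitInterval, s < t → c' '' Set.Icc s t ⊆ frontier D.carrier → (c' '' Set.Icc s t).Subsingleton :=
  fun _ hc D => hc.nonTracing_dirac D

end Summit.CriticalPhenomena.CardyFormulaZ2.Theorems.SymmetryUpgradeR.Negative

end
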